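import Summits.Langlands.Langlands.Theses.CyclicDeinductionCarving
import Summits.Langlands.Langlands.Theses.FunctorialPrimitivitySplit
import Literature.NumberTheory.Automorphic.ReciprocityGLnRankOneProofs
import Literature.NumberTheory.Automorphic.ReciprocityGLnRestrictionProofs
import Literature.NumberTheory.Automorphic.AlgebraicityParityGL
import Literature.NumberTheory.Automorphic.Sweep1Proofs
import Literature.NumberTheory.GaloisRepresentations.FramedGaloisRepSemisimplification
import Literature.NumberTheory.GaloisRepresentations.TateTwistFrobeniusProofs
import Literature.NumberTheory.GaloisRepresentations.ArtinCharacterReciprocity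

/-!
# `CyclicDeinductionCarving.RestrictionTwistTransport` — proved outright

Route `Summits/Langlands/Langlands/Theses/CyclicDeinductionCarving` (item `stmt-Langlands-29150`,
support, shared with `RootDecomp1`, `PrimitiveRankLadder`, `FunctorialPrimitivitySplit`):
**semisimple Satake avatars restrict and twist.**  For number fields `K₀ ⊆ M`, `π₀` cuspidal
`L`-algebraic on `GL_n/K₀` with a semisimple avatar `ρ₀ : Γ_{K₀} → GL_n(ℚ̄_ℓ)`
(`SatakeFrobCompatibleAt` at almost every place), an `L`-algebraic `χ` on `GL₁/M` and a cuspidal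
`L`-algebraic `P` on `GL_n/M` whose Satake parameters are a.e. `{c_w · a^{f(w|u)} : a ∈ α_u}`
(`α_u` the parameter of `π₀` below `w`, `{c_w}` that of `χ` at `w`), the representation
`r := (ρ₀|_{Γ_M} ⊗ η)^{ss}` is a semisimple avatar of `P`, where `η` is Weil's `ℓ`-adic character
of the (algebraic) Hecke character of `χ` and `(·)^{ss}` is the semisimplification (same Frobenius
characteristic polynomials, unramified wherever the twist is; so the semisimplicity of `ρ₀` is not
even used).

Every input is a theorem of the tree:
* the `GL₁` dictionary (`AutomorphicRepData.exists_heckeCharacter_glOne`,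
  `…isAlgebraic_heckeCharacter_glOne_of_isCAlgebraic`, `…isUnramifiedAt_heckeCharacter_glOne`,
  `…exists_eq_singleton_of_hasSatakeParamAt_glOne`; `IsLAlgebraic.isCAlgebraic_of_odd` for `n = 1`);
* Weil 1956 (`HeckeCharacter.IsAlgebraic.exists_lAdic`): `η` unramified with
  `char(Frob_w) = X - ι⁻¹(χ(ϖ_w))⁻¹` at the places `w ∤ ℓ` where the Hecke character is unramified;
* restriction (`hasFrobCharpolyAt_restrictField_arithFrobPolyOfSatake` — any finite `M/K₀`);
* twist (`FramedRep.twist`, `FramedGaloisRep.isUnramifiedAt_twist`,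
  `FramedGaloisRep.hasFrobCharpolyAt_twist_of_eq_prod`);
* semisimplification (`FramedGaloisRep.exists_semisimplification`, Deligne–Serre 1974, 6.12);
* finite fibres of `w ↦ w ∩ 𝓞 K₀` (`tendsto_under_cofinite`) and finiteness of the places above `ℓ`.
-/

set_option linter.dupNamespace false

open NumberField IsDedekindDomain Filter Polynomial Field
open Literature.NumberTheory.Automorphic Literature.NumberTheory.GaloisRepresentations

namespace Summit.Langlands.Langlands.Theorems

namespace RestrictionTwistTransportProof

/-- Only finitely many finite places of a number field lie above the rational prime `ℓ`
(`Ideal.finite_factors`). [folklore] -/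
theorem eventually_natCast_not_mem (M : Type*) [Field M] [NumberField M] (ℓ : ℕ) [Fact ℓ.Prime] :
    ∀ᶠ w : HeightOneSpectrum (𝓞 M) in cofinite, ((ℓ : ℕ) : 𝓞 M) ∉ w.asIdeal := by
  have hI : (Ideal.span {((ℓ : ℕ) : 𝓞 M)} : Ideal (𝓞 M)) ≠ 0 := by
    rw [Ne, Ideal.zero_eq_bot, Ideal.span_singleton_eq_bot]
    exact_mod_cast (Fact.out : ℓ.Prime).ne_zero
  have hfin : {w : HeightOneSpectrum (𝓞 M) | ((ℓ : ℕ) : 𝓞 M) ∈ w.asIdeal}.Finite := by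
    refine (Ideal.finite_factors hI).subset fun w hw => ?_
    exact (Ideal.dvd_span_singleton).2 hw
  rw [Filter.eventually_cofinite]
  simpa only [not_not] using hfin

/-- The value of the determinant character of a rank-one framed representation is its matrix entry.
[folklore] -/
theorem det_apply_eq_entry {G : Type*} [Group G] [TopologicalSpace G] {A : Type*} [CommRing A]
    [TopologicalSpace A] [IsTopologicalRing A] (η : FramedRep G A 1) (σ : G) :
    ((FramedRep.det η σ : Aˣ) : A) = ((η σ : GL (Fin 1) A) : Matrix (Fin 1) (Fin 1) A) 0 0 := by
  rw [FramedRep.det_apply, Matrix.GeneralLinearGroup.val_det_apply, Matrix.det_fin_one]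

end RestrictionTwistTransportProof

open RestrictionTwistTransportProof in
/-- **Restriction–twist transport of semisimple Satake avatars** (`RestrictionTwistTransport`,
item `stmt-Langlands-29150`), proved: `r = ρ₀|_{Γ_M} ⊗ η_χ`. -/
theorem restrictionTwistTransport_proof :
    Summit.Langlands.Langlands.Theses.CyclicDeinductionCarving.RestrictionTwistTransport := by
  intro K₀ _ _ M _ _ _ n h₀ hM h₁ _hn π₀ χ P _hπ₀ hχ _hP HBC ℓ _ ι ρ₀ _hρ₀ Hρ₀
  classical
  -- the Hecke character of `χ`, algebraic since `χ` is `L`-algebraic (= `C`-algebraic for `n = 1`)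
  obtain ⟨ψ, hψ⟩ := χ.exists_heckeCharacter_glOne
  have halg : ψ.IsAlgebraic :=
    χ.isAlgebraic_heckeCharacter_glOne_of_isCAlgebraic hψ (hχ.isCAlgebraic_of_odd odd_one)
  -- Weil's `ℓ`-adic character of `ψ`
  obtain ⟨η, hη⟩ := halg.exists_lAdic ι
  -- the semisimplification of the twist `ρ₀|_{Γ_M} ⊗ η`
  obtain ⟨r, hss, -, -, hur_of, hch_of⟩ :=
    FramedGaloisRep.exists_semisimplification (FramedRep.twist (ρ₀.restrictField M) (FramedRep.det η))
  refine ⟨r, hss, ?_⟩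
  -- four cofinite sets of places of `M`
  have e1 : ∀ᶠ w : HeightOneSpectrum (𝓞 M) in cofinite,
      SatakeFrobCompatibleAt ι π₀.1 ρ₀ (w.under (𝓞 K₀)) :=
    (tendsto_under_cofinite (𝓞 K₀)).eventually Hρ₀
  have e2 := eventually_natCast_not_mem M ℓ
  have e3 := χ.hasSatakeParamAt_cofinite_holds
  filter_upwards [HBC, e1, e2, e3] with w hBC h1 h2 h3
  obtain ⟨α, hα, hur₀, hch₀⟩ := h1
  obtain ⟨β, hβ⟩ := h3
  obtain ⟨ϖ, hϖ, rfl⟩ := χ.exists_eq_singleton_of_hasSatakeParamAt_glOne hψ hβ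
  -- `ψ` is unramified at `w` with `ψ(ϖ_w) = c`
  have hurψ : ψ.IsUnramifiedAt w := χ.isUnramifiedAt_heckeCharacter_glOne hψ hβ
  have hc : ((ψ (localUnits w ϖ) : ℂˣ) : ℂ) = ψ.valueAtUniformizer w := by
    rw [← HeckeCharacter.localComponent_eq_valueAtUniformizer hurψ hϖ,
      HeckeCharacter.localComponent_apply]
  obtain ⟨hurη, hchη⟩ := hη w h2 hurψ
  -- the Satake parameter of `P` at `w`
  have hPw := hBC (w.under (𝓞 K₀)) α ((ψ (localUnits w ϖ) : ℂˣ) : ℂ) rfl hα hβ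
  -- restriction to `Γ_M`
  obtain ⟨hur₁, hch₁⟩ := hasFrobCharpolyAt_restrictField_arithFrobPolyOfSatake (L := M) ι ρ₀
    (v := w.under (𝓞 K₀)) (w := w) rfl hur₀ 1 hch₀
  refine ⟨_, hPw, ?_, ?_⟩
  · -- unramified
    exact hur_of w (FramedGaloisRep.isUnramifiedAt_twist hur₁ fun 𝔓 h𝔓 σ hσ => by
      rw [FramedRep.det_apply, hurη 𝔓 h𝔓 σ hσ, map_one])
  · -- characteristic polynomial of Frobenius
    set c : ℂ := ((ψ (localUnits w ϖ) : ℂˣ) : ℂ) with hcdef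
    have hd : ∀ 𝔓 ∈ w.primesAbove, ∀ σ : absoluteGaloisGroup M, IsArithFrobAt (𝓞 M) σ 𝔓 →
        ((FramedRep.det η σ : (PadicAlgCl ℓ)ˣ) : PadicAlgCl ℓ) = ι.symm c⁻¹ := by
      intro 𝔓 h𝔓 σ hσ
      have h00 := (FramedGaloisRep.hasFrobCharpolyAt_iff_of_rank_one η w _).mp hchη 𝔓 h𝔓 σ hσ
      rw [det_apply_eq_entry, h00, hc]
    have hρ : (ρ₀.restrictField M).HasFrobCharpolyAt w
        ((((α.map (· ^ w.asIdeal.inertiaDeg (𝓞 K₀))).map fun a => ι.symm a⁻¹).map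
          fun b => X - C b).prod) := by
      rw [Multiset.map_map]
      rw [arithFrobPolyOfSatake_one] at hch₁
      exact hch₁
    have key := FramedGaloisRep.hasFrobCharpolyAt_twist_of_eq_prod hρ hd
    have hpoly : arithFrobPolyOfSatake ι w.residueCard 1
        ((α.map (· ^ w.asIdeal.inertiaDeg (𝓞 K₀))).map (c * ·)) =
        ((((α.map (· ^ w.asIdeal.inertiaDeg (𝓞 K₀))).map fun a => ι.symm a⁻¹).map
          fun b => X - C (ι.symm c⁻¹ * b)).prod) := by
      rw [arithFrobPolyOfSatake_one]
      simp only [Multiset.map_map, Function.comp_def]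
      congr 1
      refine Multiset.map_congr rfl fun a _ => ?_
      rw [mul_inv, map_mul]
    rw [hpoly]
    exact hch_of w _ key

/-- The same statement as filed on route `RootDecomp1` (shared item, rank 304 there). -/
theorem restrictionTwistTransport_rootDecomp1 :
    Summit.Langlands.Langlands.Theses.RootDecomp1.RestrictionTwistTransport :=
  restrictionTwistTransport_proof

/-- The same statement as filed on route `FunctorialPrimitivitySplit` (shared item). -/
theorem restrictionTwistTransport_functorialPrimitivitySplit :
    Summit.Langlands.Langlands.Theses.FunctorialPrimitivitySplit.RestrictionTwistTransport :=
  restrictionTwistTransport_proof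

end Summit.Langlands.Langlands.Theorems
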